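import Mathlib
import Summits.NavierStokesRegularity.NavierStokesRegularity.Theorems.FilamentSkeletonRssStadiumRightWingPos
import Summits.NavierStokesRegularity.NavierStokesRegularity.Theorems.FilamentSkeletonRssStadiumCornerConj

/-!
# Route `FilamentSkeletonRss` · cruxes `SkeletonJ1L` (stmt-NavierStokesRegularity-23296, registered stub `stub_tangentSkeletonL` ≡
# `TangentSkeletonNearStraightL`, stmt-23320) · line `child_tangent_analytic_strip_L` (b0b56c52900dd90a), stub `stub_stripPropagation` —
# brick for `rcore`: THE RIGHT WING OF AN ANCHOR BELOW THE AXIS (transport of the descent certificate by conjugation)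

`Theorems.StadiumRightWingPos.right_descent_pos` needs `0 ≤ Y₀`; the plateau lemma already allows `|Y₀| < hs/4`.  For an anchor BELOW the axis
(`−hs/4 < Y₀ ≤ 0`) the descent `[z₀ + hs/5, x₀ + hs/2]` rises to the real axis and is the complex conjugate of the descent of the conjugate anchor
`x₀ + i|Y₀|`; by the conjugation symmetry of the stadium continuation (`Theorems.StadiumCornerConj.chord_sq_conj`, `F` real on the trace) the chord
square has the same real part at conjugate pairs, and the certificates hold for ANY core value of real part `≥ g₀` — so the descent positivity
transports verbatim (`right_descent_pos_lower`).  With `right_plateau_pos` this covers the right wing of every corner-normalised anchor of either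
sign, as `Theorems.StadiumFrozenPolygon` / `…TentFreezeNhds` consume it.
HONEST FRAMING: bookkeeping for a HYPOTHETICAL filament skeleton on the NEGATIVE side of a MODEL route; the stub `stub_stripPropagation` is NOT closed
by this file, `TangentSkeletonNearStraightL` / `SkeletonJ1L` stay OPEN; nothing here bears on Navier–Stokes regularity or blow-up.
`--supports stmt-NavierStokesRegularity-23320` (≡ stub `stub_tangentSkeletonL` of 23296).
-/

set_option linter.dupNamespace false

noncomputable section

namespace Summit.NavierStokesRegularity.NavierStokesRegularity.Theorems.StadiumRightWingPosLower

open Set Complex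
open scoped InnerProductSpace ComplexConjugate
open Summit.NavierStokesRegularity.NavierStokesRegularity.Theorems.StadiumRightWingPos
open Summit.NavierStokesRegularity.NavierStokesRegularity.Theorems.StadiumCornerConj

/-- **Descent positivity for an anchor below the axis.**  `−hs/4 < Y₀ ≤ 0`, `cc ≤ x₀ < cc + L + hs/4`, `F` holomorphic with `‖F′‖ ≤ 2`,
`Σ F′ᵢ² = 1` and real trace `X`, core continuation with `Re G ≥ g₀ > 0` on the stadium, `κ > 0`: for `t ∈ [0,1]`,
`0 < Re(Σᵢ (Fᵢ z₀ − Fᵢ(p + t(q−p)))² + κ G(p + t(q−p)))` with `p = z₀ + hs/5`, `q = x₀ + hs/2`. [folklore] -/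
theorem right_descent_pos_lower {hs L cc : ℝ} {F : ℂ → (Fin 3 → ℂ)}
    (hF : DifferentiableOn ℂ F {z : ℂ | |z.im| < hs ∧ |z.re - cc| < L + hs})
    (hM : ∀ z ∈ {z : ℂ | |z.im| < hs ∧ |z.re - cc| < L + hs}, ‖deriv F z‖ ≤ 2)
    (hunit : ∀ w ∈ {z : ℂ | |z.im| < hs ∧ |z.re - cc| < L + hs}, ∑ i, (deriv F w i) ^ 2 = 1)
    {X : ℝ → EuclideanSpace ℝ (Fin 3)} (hX : ContDiff ℝ 1 X) (hXu : ∀ τ, ‖deriv X τ‖ = 1)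
    {Rb : ℝ} (hRb0 : 0 ≤ Rb) (hRb : Rb ≤ 1 / 2) (hosc : ∀ τ σ, ‖deriv X τ - deriv X σ‖ ≤ Rb)
    (hFX : ∀ r : ℝ, (r : ℂ) ∈ {z : ℂ | |z.im| < hs ∧ |z.re - cc| < L + hs} →
      F r = fun i => ((⟪X r, EuclideanSpace.single i (1:ℝ)⟫_ℝ : ℝ) : ℂ))
    (hhs : 0 < hs) {x₀ Y₀ : ℝ} (hY0 : Y₀ ≤ 0) (hY : -(hs / 4) < Y₀) (hx₀ : x₀ < cc + L + hs / 4) (hx₀cc : cc ≤ x₀)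
    {G : ℂ → ℂ} {κ g₀ : ℝ} (hκ : 0 < κ) (hg₀ : 0 < g₀)
    (hG : ∀ w ∈ {z : ℂ | |z.im| < hs ∧ |z.re - cc| < L + hs}, g₀ ≤ (G w).re) :
    ∀ t ∈ Icc (0:ℝ) 1,
      0 < ((∑ i, (F ((x₀ : ℂ) + (Y₀ : ℂ) * Complex.I) i -
          F ((((x₀ + hs / 5 : ℝ) : ℂ) + (Y₀ : ℂ) * Complex.I) + (t : ℂ) *
            (((x₀ + hs / 2 : ℝ) : ℂ) - (((x₀ + hs / 5 : ℝ) : ℂ) + (Y₀ : ℂ) * Complex.I))) i) ^ 2) +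
        (κ : ℂ) * G ((((x₀ + hs / 5 : ℝ) : ℂ) + (Y₀ : ℂ) * Complex.I) + (t : ℂ) *
            (((x₀ + hs / 2 : ℝ) : ℂ) - (((x₀ + hs / 5 : ℝ) : ℂ) + (Y₀ : ℂ) * Complex.I)))).re := by
  intro t ht
  set S : Set ℂ := {z : ℂ | |z.im| < hs ∧ |z.re - cc| < L + hs} with hS
  have hLs : 0 < L + hs := by linarith [hx₀cc, hx₀]
  -- the conjugate anchor is above the axis
  set Y' : ℝ := -Y₀ with hY'
  have hY'0 : 0 ≤ Y' := by rw [hY']; linarith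
  have hY'lt : Y' < hs / 4 := by rw [hY']; linarith
  -- the conjugated core continuation keeps the floor
  set G' : ℂ → ℂ := fun w => G (conj w) with hG'
  have hconjS : ∀ w ∈ S, conj w ∈ S := fun w hw => by
    refine ⟨?_, ?_⟩
    · simpa [Complex.conj_im, abs_neg] using hw.1
    · simpa [Complex.conj_re] using hw.2
  have hG'floor : ∀ w ∈ S, g₀ ≤ (G' w).re := fun w hw => hG _ (hconjS w hw)
  have hup := right_descent_pos hF hM hunit hX hXu hRb0 hRb hosc hFX hhs hY'0 hY'lt hx₀ hx₀cc (G := G') hκ hg₀ hG'floor t ht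
  -- the lower points are the conjugates of the upper points
  set z₀ : ℂ := (x₀ : ℂ) + (Y₀ : ℂ) * Complex.I with hz₀
  set ζ : ℂ := (((x₀ + hs / 5 : ℝ) : ℂ) + (Y₀ : ℂ) * Complex.I) + (t : ℂ) *
      (((x₀ + hs / 2 : ℝ) : ℂ) - (((x₀ + hs / 5 : ℝ) : ℂ) + (Y₀ : ℂ) * Complex.I)) with hζ
  have e : ζ = (((x₀ + (hs / 5 + 3 * hs / 10 * t)) : ℝ) : ℂ) + ((Y₀ * (1 - t) : ℝ) : ℂ) * Complex.I := by
    rw [hζ]; push_cast; ring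
  have ez : (x₀ : ℂ) + (Y' : ℂ) * Complex.I = conj z₀ := by
    apply Complex.ext <;> simp [hz₀, hY']
  have eζ : (((x₀ + hs / 5 : ℝ) : ℂ) + (Y' : ℂ) * Complex.I) + (t : ℂ) *
      (((x₀ + hs / 2 : ℝ) : ℂ) - (((x₀ + hs / 5 : ℝ) : ℂ) + (Y' : ℂ) * Complex.I)) = conj ζ := by
    have e' : (((x₀ + hs / 5 : ℝ) : ℂ) + (Y' : ℂ) * Complex.I) + (t : ℂ) *
        (((x₀ + hs / 2 : ℝ) : ℂ) - (((x₀ + hs / 5 : ℝ) : ℂ) + (Y' : ℂ) * Complex.I)) =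
        (((x₀ + (hs / 5 + 3 * hs / 10 * t)) : ℝ) : ℂ) + ((Y' * (1 - t) : ℝ) : ℂ) * Complex.I := by
      push_cast; ring
    rw [e', e]
    set A : ℝ := x₀ + (hs / 5 + 3 * hs / 10 * t) with hA
    set B : ℝ := Y₀ * (1 - t) with hB
    have hB' : Y' * (1 - t) = -B := by rw [hY', hB]; ring
    rw [hB']
    apply Complex.ext <;> simp
  rw [ez, eζ] at hup
  -- `G' (conj ζ) = G ζ` and the chord square has the same real part at the conjugate pair
  have hG'ζ : G' (conj ζ) = G ζ := by simp [hG']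
  rw [hG'ζ] at hup
  have hz₀S : z₀ ∈ S := by
    refine ⟨?_, ?_⟩
    · simp [hz₀]; rw [abs_lt]; constructor <;> linarith
    · simp [hz₀]; rw [abs_lt]; constructor <;> linarith
  have hζS : ζ ∈ S := by
    rw [e]
    refine ⟨?_, ?_⟩
    · simp
      rw [abs_of_nonneg (sub_nonneg.mpr ht.2)]
      have : |Y₀| < hs / 4 := by rw [abs_lt]; constructor <;> linarith
      nlinarith [abs_nonneg Y₀, ht.1, ht.2]
    · simp; rw [abs_lt]; constructor <;> nlinarith [ht.1, ht.2]
  have hconj := (chord_sq_conj hF hFX hhs hLs hz₀S hζS).2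
  -- `Re Σ (F (conj ζ) − F (conj z₀))² = Re Σ (F ζ − F z₀)²`; orientation of the chord is immaterial
  have hsq : ∀ a b : ℂ, (∑ i, (F a i - F b i) ^ 2) = ∑ i, (F b i - F a i) ^ 2 :=
    fun a b => Finset.sum_congr rfl fun i _ => by ring
  rw [Complex.add_re] at hup ⊢
  rw [hsq (conj z₀) (conj ζ), hconj, ← hsq] at hup
  exact hup

end Summit.NavierStokesRegularity.NavierStokesRegularity.Theorems.StadiumRightWingPosLower

end
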